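import Summits.ResolutionOfSingularities.ResolutionOfSingularities.Theorems.FrobeniusClosingDefs

/-!
# Crux `ClosingReduction`, line `chart-factorization`: the stub `stub_unwinding`

Route `ResolutionOfSingularities/FrobeniusClosing`, crux `ClosingReduction`
(stmt-ResolutionOfSingularities-16347), line `chart-factorization`
(`Cruxes/ClosingReduction/Lines/chart_factorization.lean`), stub `stub_unwinding : PairIsoKit →
Transport → LoewyKit → Unwinding` (all four statements are the named propositions of
`Theorems/FrobeniusClosingDefs.lean`).

`Unwinding`: over a field `K` algebraic over `𝔽_p`, a finite returning chain
`c 0 → c 1 → ⋯ → c r = c 0` (`r > 0`) of bounded successor pairs `BddSucc p n β K (c m) (c (m+1))`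
is realised by an HONEST run `run p n K d₀ i t` with all states `0..r'` isolated of multiplicity `p`
and `PairIso (run 0) (run r')`.

Proof (pure logic along the finite chain; no power-series mathematics). `K` has characteristic
`p` (it is a `ZMod p`-algebra) and is perfect (algebraic over the perfect field `ZMod p`), so the
kit `PairIsoKit` and the transport `Transport` apply over `K`. By induction on `m ≤ r` we build
chart and translation words `i`, `t` with `Isol`, `MultP` and `PairIso (c k) (run (c 0) i t k)` for
all `k ≤ m`: at `m = 0` this is reflexivity of `PairIso` (and `JacPow → Isol` from `LoewyKit`); at
`m → m + 1` the pair `BddSucc (c m) (c (m+1))` provides an honest successor `step i₀ τ₀ (c m)`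
pair-isomorphic to `c (m+1)`, `Transport` moves it along `PairIso (c m) (run m)` to a successor
`step i' τ' (run m)`, and we overwrite the words at place `m` by `(i', τ')` (`Function.update`; the
states `≤ m` are unchanged, `UnwindingProof.run_congr`); `Isol`/`MultP` of the new state and
`PairIso (c (m+1)) (run (m+1))` follow from the symmetry, transitivity and invariance components of
`PairIsoKit`. At `m = r`, `c r = c 0 = run 0` gives `PairIso (run 0) (run r)`.
-/

noncomputable section

-- single-problem summit: the doubled namespace component is forced
set_option linter.dupNamespace false

open scoped BigOperators Classical

namespace Summit.ResolutionOfSingularities.ResolutionOfSingularities.Theorems.FrobeniusClosing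

namespace UnwindingProof

variable {p n : ℕ} {K : Type} [Field K]

/-- The run starts at `c₀` (definitional). [folklore] -/
theorem run_zero (c₀ : (Fin n → ℕ) → K) (i : ℕ → Fin n) (t : ℕ → Fin n → K) :
    run p n K c₀ i t 0 = c₀ :=
  rfl

/-- The `(m+1)`-st state is the move `(i m, t m)` applied to the `m`-th state (definitional).
[folklore] -/
theorem run_succ (c₀ : (Fin n → ℕ) → K) (i : ℕ → Fin n) (t : ℕ → Fin n → K) (m : ℕ) :
    run p n K c₀ i t (m + 1) = step p n K (i m) (t m) (run p n K c₀ i t m) :=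
  rfl

/-- The states `0..m` of a run only depend on the letters `< m` of the chart and translation words.
[folklore] -/
theorem run_congr (c₀ : (Fin n → ℕ) → K) {i i' : ℕ → Fin n} {t t' : ℕ → Fin n → K} {m : ℕ}
    (hi : ∀ k, k < m → i k = i' k) (ht : ∀ k, k < m → t k = t' k) :
    ∀ k, k ≤ m → run p n K c₀ i t k = run p n K c₀ i' t' k := by
  intro k
  induction k with
  | zero =>
    intro
    rfl
  | succ k ih =>
    intro hk
    rw [run_succ, run_succ, ih (Nat.le_of_succ_le hk), hi k (Nat.lt_of_succ_le hk),
      ht k (Nat.lt_of_succ_le hk)]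

/-- The inductive realisation of the chain by an honest run from `c 0`: for every `m ≤ r` there are
chart and translation words whose run from `c 0` has its states `k ≤ m` isolated, of multiplicity
`p`, and pair-isomorphic to `c k` (one transport per step). [folklore] -/
theorem realise (hK : PairIsoKit) (hT : Transport) (hL : LoewyKit) (hp : p.Prime) (hn : 0 < n)
    [CharP K p] [PerfectField K] (β : ℕ) (c : ℕ → (Fin n → ℕ) → K) (r : ℕ) (hr : 0 < r)
    (hc : ∀ m, m < r → BddSucc p n β K (c m) (c (m + 1))) :
    ∀ m, m ≤ r → ∃ (i : ℕ → Fin n) (t : ℕ → Fin n → K), ∀ k, k ≤ m →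
      Isol p n K (run p n K (c 0) i t k) ∧ MultP p n K (run p n K (c 0) i t k) ∧
        PairIso p n K (c k) (run p n K (c 0) i t k) := by
  intro m
  induction m with
  | zero =>
    intro
    obtain ⟨i₀, τ₀, ⟨hJ0, hM0⟩, -, -, -⟩ := hc 0 hr
    refine ⟨fun _ => i₀, fun _ => τ₀, fun k hk => ?_⟩
    obtain rfl := Nat.le_zero.mp hk
    exact ⟨hL.2.1 p n K (c 0) β hJ0, hM0, pairIso_refl hp.ne_zero n K (c 0)⟩
  | succ m ih =>
    intro hm
    obtain ⟨i, t, hit⟩ := ih (Nat.le_of_succ_le hm)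
    -- the bounded successor pair `c m → c (m+1)` and its honest successor `step i₀ τ₀ (c m)`
    obtain ⟨i₀, τ₀, ⟨-, hMm⟩, ⟨hJs, hMs⟩, -, hPs⟩ := hc m (Nat.lt_of_succ_le hm)
    obtain ⟨-, -, hPm⟩ := hit m le_rfl
    -- transport the successor along `PairIso (c m) (run m)`
    obtain ⟨i', τ', hP'⟩ := hT p hp n hn K (c m) (run p n K (c 0) i t m) hPm hMm i₀ τ₀
    obtain ⟨hsymm, htrans, hinv⟩ := hK p hp n hn K
    refine ⟨Function.update i m i', Function.update t m τ', fun k hk => ?_⟩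
    have hagree : ∀ k, k ≤ m →
        run p n K (c 0) (Function.update i m i') (Function.update t m τ') k =
          run p n K (c 0) i t k :=
      run_congr (c 0) (fun k hk => Function.update_of_ne (Nat.ne_of_lt hk) _ _)
        (fun k hk => Function.update_of_ne (Nat.ne_of_lt hk) _ _)
    rcases Nat.lt_succ_iff_lt_or_eq.mp (Nat.lt_succ_of_le hk) with hk' | rfl
    · rw [hagree k (Nat.lt_succ_iff.mp hk')]
      exact hit k (Nat.lt_succ_iff.mp hk')
    · have hrun : run p n K (c 0) (Function.update i m i') (Function.update t m τ') (m + 1) =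
          step p n K i' τ' (run p n K (c 0) i t m) := by
        rw [run_succ, hagree m le_rfl, Function.update_self, Function.update_self]
      rw [hrun]
      obtain ⟨hI, hM, -⟩ := hinv _ _ hP'
      exact ⟨hI.mp (hL.2.1 p n K _ β hJs), hM.mp hMs, htrans _ _ _ (hsymm _ _ hPs) hP'⟩

end UnwindingProof

/-- **Unwinding** (stub `stub_unwinding` of line `chart-factorization` of crux `ClosingReduction`):
given the pair-isomorphism kit, the transport of successor points and the Loewy lemmas, over a field
`K` algebraic over `𝔽_p` every finite returning chain `c 0 → ⋯ → c r = c 0` (`r > 0`) of bounded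
successor pairs is realised by an honest run from `c 0` of length `r` with all states isolated of
multiplicity `p` and `PairIso (run 0) (run r)`. (`K` is of characteristic `p` and perfect, being
algebraic over the perfect field `ZMod p`; then `UnwindingProof.realise` at `m = r`.) [folklore] -/
theorem stub_unwinding (hK : PairIsoKit) (hT : Transport) (hL : LoewyKit) : Unwinding := by
  intro p hp n hn β K _ _ _ c r hr hcr hc
  haveI : Fact p.Prime := ⟨hp⟩
  haveI : CharP K p := charP_of_injective_algebraMap (algebraMap (ZMod p) K).injective p
  haveI : PerfectField K := Algebra.IsAlgebraic.perfectField (ZMod p)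
  obtain ⟨i, t, h⟩ := UnwindingProof.realise hK hT hL hp hn β c r hr hc r le_rfl
  refine ⟨c 0, i, t, r, hr, fun m hm => ⟨(h m hm).1, (h m hm).2.1⟩, ?_⟩
  have hP := (h r le_rfl).2.2
  rw [hcr] at hP
  rw [UnwindingProof.run_zero]
  exact hP

end Summit.ResolutionOfSingularities.ResolutionOfSingularities.Theorems.FrobeniusClosing

end
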